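import Mathlib
import Summits.Ventures.PercRepro2.Defs
import Summits.Ventures.PercRepro2.Harris

/-!
# The (T) form of three events reduces to antipodal base cases (blind cell PercRepro2, mine-a g41)

For events `Q U e` of a finite bond configuration space and two weight vectors `p₁ p₂`, the
*two-law (T) form* is

  `gform Q U e p₁ p₂ = P₁(Q ∩ U ∩ e) + P₁(Q) P₂(U ∩ e) − P₁(Q ∩ U) P₂(e) − P₁(Q ∩ e) P₂(U)`

(`= E[Q(ω₁)(U(ω₁) − U(ω₂))(e(ω₁) − e(ω₂))]` for independent `ω₁ ∼ P₁`, `ω₂ ∼ P₂`); the cell's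
three-event inequality (T) (TFKG.lean) is `0 ≤ gform Q U e p p`.  For a set `D` of edges the
*antipodal sum* is

  `kform Q U e D p = Σ_{σ supported on D} gform Q U e p[σ on D] p[σ̄ on D]`

(the two copies pinned to complementary states on `D`, the weights `p` elsewhere).  The pinning
identity of one free edge `g ∉ D` (`kform_pin`) reads

  `K_D(p) = (1 − p g)² K_D(p[g↦0]) + (p g)² K_D(p[g↦1]) + p g (1 − p g) K_{D ∪ {g}}(p)`,

with nonnegative coefficients for admissible weights, so (`kform_nonneg_of_base`) every `K_D(p)`,
in particular `K_∅(p) = gform p p`, is nonnegative as soon as the *base cases* — no free edge, i.e.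
`p` is `0/1`-valued off `D` — are.  At such a base case `kform` is a purely combinatorial sum over the 2-colourings
of `D` (TReductionBase.lean, `kform_eq_antipodal_sum`): the uniform 2-colouring inequality (K₀⁰)
of MINE-A.md §96 on the minor of the graph.  Nothing here uses monotonicity or the graph: the
reduction is pure algebra of the pinning identity `Defs.prob_eq_pin`, valid for arbitrary events.
No instance, no notation.
-/

namespace Summit.Ventures.PercRepro2

namespace TReduction

open Finset

section Forms

variable {E : Type*} [Fintype E] [DecidableEq E] {R : Type*} [CommRing R]

/-- The two-law (T) form `P₁(Q∩U∩e) + P₁(Q) P₂(U∩e) − P₁(Q∩U) P₂(e) − P₁(Q∩e) P₂(U)`. -/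
noncomputable def gform (Q U e : Set (Config E)) (p₁ p₂ : E → R) : R :=
  prob p₁ (Q ∩ U ∩ e) + prob p₁ Q * prob p₂ (U ∩ e) - prob p₁ (Q ∩ U) * prob p₂ e
    - prob p₁ (Q ∩ e) * prob p₂ U

/-- The weights `p` with the edges of `D` pinned to the states of `σ` (`true ↦ 1`, `false ↦ 0`). -/
def pinD (p : E → R) (D : Finset E) (σ : Config E) : E → R :=
  fun x => if x ∈ D then (if σ x then 1 else 0) else p x

/-- The configurations supported on `D` (closed off `D`). -/
def suppOn (D : Finset E) : Finset (Config E) :=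
  univ.filter fun σ => ∀ x, x ∉ D → σ x = false

/-- The antipodal sum `K_D(p) = Σ_{σ supported on D} gform p[σ] p[σ̄]`. -/
noncomputable def kform (Q U e : Set (Config E)) (D : Finset E) (p : E → R) : R :=
  ∑ σ ∈ suppOn D, gform Q U e (pinD p D σ) (pinD p D fun x => !σ x)

/-- Membership in `suppOn`. -/
lemma mem_suppOn {D : Finset E} {σ : Config E} : σ ∈ suppOn D ↔ ∀ x, x ∉ D → σ x = false := by
  simp [suppOn]

omit [Fintype E] in
/-- `pinD` at an edge of `D`. -/
lemma pinD_of_mem (p : E → R) {D : Finset E} (σ : Config E) {x : E} (hx : x ∈ D) :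
    pinD p D σ x = if σ x then 1 else 0 := by
  simp [pinD, hx]

omit [Fintype E] in
/-- `pinD` at an edge outside `D`. -/
lemma pinD_of_not_mem (p : E → R) {D : Finset E} (σ : Config E) {x : E} (hx : x ∉ D) :
    pinD p D σ x = p x := by
  simp [pinD, hx]

omit [Fintype E] in
/-- Updating a free edge commutes with pinning `D`. -/
lemma pinD_update (p : E → R) {D : Finset E} (σ : Config E) {g : E} (hg : g ∉ D) (v : R) :
    pinD (Function.update p g v) D σ = Function.update (pinD p D σ) g v := by
  ext x
  by_cases hx : x = g
  · subst hx; simp [pinD, hg]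
  · by_cases hxD : x ∈ D
    · simp [pinD, hxD, Function.update_of_ne hx]
    · simp [pinD, hxD, Function.update_of_ne hx]

omit [Fintype E] in
/-- `pinD` over the empty set is `p`. -/
lemma pinD_empty (p : E → R) (σ : Config E) : pinD p ∅ σ = p := by
  ext x; simp [pinD]

omit [Fintype E] in
/-- Pinning `insert g D` on a configuration open at `g` is pinning `D` with `g` pinned open. -/
lemma pinD_insert_true (p : E → R) {D : Finset E} (σ : Config E) {g : E} (hg : g ∉ D) :
    pinD p (insert g D) (Function.update σ g true) = pinD (Function.update p g 1) D σ := by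
  ext x
  by_cases hx : x = g
  · subst hx; simp [pinD, hg]
  · by_cases hxD : x ∈ D
    · simp [pinD, hxD, Function.update_of_ne hx]
    · simp [pinD, hxD, hx]

omit [Fintype E] in
/-- The antipode of a configuration open at `g`, pinned on `insert g D`, is the antipode pinned on
`D` with `g` pinned closed. -/
lemma pinD_insert_not_true (p : E → R) {D : Finset E} (σ : Config E) {g : E} (hg : g ∉ D) :
    pinD p (insert g D) (fun x => !Function.update σ g true x) =
      pinD (Function.update p g 0) D fun x => !σ x := by
  ext x
  by_cases hx : x = g
  · subst hx; simp [pinD, hg]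
  · by_cases hxD : x ∈ D
    · simp [pinD, hxD, Function.update_of_ne hx]
    · simp [pinD, hxD, hx]

omit [Fintype E] in
/-- Pinning `insert g D` on a configuration closed at `g` is pinning `D` with `g` pinned closed. -/
lemma pinD_insert_false (p : E → R) {D : Finset E} {σ : Config E} {g : E} (hg : g ∉ D)
    (hσ : σ g = false) : pinD p (insert g D) σ = pinD (Function.update p g 0) D σ := by
  ext x
  by_cases hx : x = g
  · subst hx; simp [pinD, hg, hσ]
  · by_cases hxD : x ∈ D
    · simp [pinD, hxD]
    · simp [pinD, hxD, hx]

omit [Fintype E] in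
/-- The antipode of a configuration closed at `g`, pinned on `insert g D`, is the antipode pinned
on `D` with `g` pinned open. -/
lemma pinD_insert_not_false (p : E → R) {D : Finset E} {σ : Config E} {g : E} (hg : g ∉ D)
    (hσ : σ g = false) :
    pinD p (insert g D) (fun x => !σ x) = pinD (Function.update p g 1) D fun x => !σ x := by
  ext x
  by_cases hx : x = g
  · subst hx; simp [pinD, hg, hσ]
  · by_cases hxD : x ∈ D
    · simp [pinD, hxD]
    · simp [pinD, hxD, hx]

/-- **Pinning the form in one edge, both copies**: with `t₁ = p₁ g`, `t₂ = p₂ g`,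
`gform p₁ p₂ = Σ_{α β} t₁^α t₂^β gform p₁[g↦α] p₂[g↦β]`. -/
lemma gform_pin (Q U e : Set (Config E)) (p₁ p₂ : E → R) (g : E) :
    gform Q U e p₁ p₂ =
      p₁ g * p₂ g * gform Q U e (Function.update p₁ g 1) (Function.update p₂ g 1)
        + p₁ g * (1 - p₂ g) * gform Q U e (Function.update p₁ g 1) (Function.update p₂ g 0)
        + (1 - p₁ g) * p₂ g * gform Q U e (Function.update p₁ g 0) (Function.update p₂ g 1)
        + (1 - p₁ g) * (1 - p₂ g) * gform Q U e (Function.update p₁ g 0) (Function.update p₂ g 0) := by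
  unfold gform
  rw [prob_eq_pin p₁ (Q ∩ U ∩ e) g, prob_eq_pin p₁ Q g, prob_eq_pin p₂ (U ∩ e) g,
    prob_eq_pin p₁ (Q ∩ U) g, prob_eq_pin p₂ e g, prob_eq_pin p₁ (Q ∩ e) g, prob_eq_pin p₂ U g]
  ring


/-- `suppOn (insert g D)` restricted to the configurations closed at `g` is `suppOn D`. -/
lemma suppOn_insert_filter_false {D : Finset E} {g : E} (hg : g ∉ D) :
    (suppOn (insert g D)).filter (fun σ => σ g = false) = suppOn D := by
  ext σ
  simp only [mem_filter, mem_suppOn, mem_insert]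
  constructor
  · rintro ⟨h, hg'⟩ x hx
    by_cases hxg : x = g
    · subst hxg; exact hg'
    · exact h x (by tauto)
  · intro h
    exact ⟨fun x hx => h x fun hxD => hx (Or.inr hxD), h g hg⟩

/-- `suppOn (insert g D)` restricted to the configurations open at `g` is the image of `suppOn D`
under opening `g`. -/
lemma suppOn_insert_filter_true {D : Finset E} {g : E} (hg : g ∉ D) :
    (suppOn (insert g D)).filter (fun σ => σ g = true) =
      (suppOn D).image fun σ => Function.update σ g true := by
  ext σ
  simp only [mem_filter, mem_suppOn, mem_insert, mem_image]
  constructor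
  · rintro ⟨h, hg'⟩
    refine ⟨Function.update σ g false, fun x hx => ?_, ?_⟩
    · by_cases hxg : x = g
      · subst hxg; simp
      · rw [Function.update_of_ne hxg]; exact h x (by tauto)
    · ext x
      by_cases hxg : x = g
      · subst hxg; simp [hg']
      · simp [Function.update_of_ne hxg]
  · rintro ⟨τ, hτ, rfl⟩
    refine ⟨fun x hx => ?_, by simp⟩
    have hxg : x ≠ g := fun h => hx (Or.inl h)
    rw [Function.update_of_ne hxg]
    exact hτ x fun hxD => hx (Or.inr hxD)

/-- Opening `g` is injective on `suppOn D` when `g ∉ D`. -/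
lemma update_true_injOn {D : Finset E} {g : E} (hg : g ∉ D) :
    Set.InjOn (fun σ : Config E => Function.update σ g true) (suppOn D : Set (Config E)) := by
  intro σ hσ τ hτ h
  have hσg : σ g = false := (mem_suppOn.1 hσ) g hg
  have hτg : τ g = false := (mem_suppOn.1 hτ) g hg
  ext x
  by_cases hxg : x = g
  · subst hxg; rw [hσg, hτg]
  · have := congrFun h x
    simp only at this
    rwa [Function.update_of_ne hxg, Function.update_of_ne hxg] at this

/-- **The antipodal sum over `insert g D`** is the sum of the two crossed pinnings of `g`. -/
lemma kform_insert (Q U e : Set (Config E)) {D : Finset E} {g : E} (hg : g ∉ D) (p : E → R) :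
    kform Q U e (insert g D) p =
      (∑ σ ∈ suppOn D, gform Q U e (pinD (Function.update p g 1) D σ)
          (pinD (Function.update p g 0) D fun x => !σ x))
      + ∑ σ ∈ suppOn D, gform Q U e (pinD (Function.update p g 0) D σ)
          (pinD (Function.update p g 1) D fun x => !σ x) := by
  unfold kform
  rw [← sum_filter_add_sum_filter_not (suppOn (insert g D)) (fun σ => σ g = true)]
  have hnot : (suppOn (insert g D)).filter (fun σ => ¬ σ g = true) =
      (suppOn (insert g D)).filter (fun σ => σ g = false) := by
    apply filter_congr
    intro σ _
    simp
  rw [hnot, suppOn_insert_filter_false hg, suppOn_insert_filter_true hg,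
    sum_image (update_true_injOn hg)]
  congr 1
  · refine sum_congr rfl fun σ _ => ?_
    rw [pinD_insert_true p σ hg, pinD_insert_not_true p σ hg]
  · refine sum_congr rfl fun σ hσ => ?_
    have hσg : σ g = false := (mem_suppOn.1 hσ) g hg
    rw [pinD_insert_false p hg hσg, pinD_insert_not_false p hg hσg]

/-- **The pinning identity of the antipodal sums**: for a free edge `g ∉ D`,
`K_D(p) = (1 − p g)² K_D(p[g↦0]) + (p g)² K_D(p[g↦1]) + p g (1 − p g) K_{D ∪ {g}}(p)`. -/
theorem kform_pin (Q U e : Set (Config E)) {D : Finset E} {g : E} (hg : g ∉ D) (p : E → R) :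
    kform Q U e D p =
      (1 - p g) ^ 2 * kform Q U e D (Function.update p g 0)
        + p g ^ 2 * kform Q U e D (Function.update p g 1)
        + p g * (1 - p g) * kform Q U e (insert g D) p := by
  rw [kform_insert Q U e hg p]
  unfold kform
  have key : ∀ σ ∈ suppOn D,
      gform Q U e (pinD p D σ) (pinD p D fun x => !σ x) =
        (1 - p g) ^ 2 * gform Q U e (pinD (Function.update p g 0) D σ)
            (pinD (Function.update p g 0) D fun x => !σ x)
          + p g ^ 2 * gform Q U e (pinD (Function.update p g 1) D σ)
            (pinD (Function.update p g 1) D fun x => !σ x)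
          + p g * (1 - p g) * (gform Q U e (pinD (Function.update p g 1) D σ)
              (pinD (Function.update p g 0) D fun x => !σ x)
            + gform Q U e (pinD (Function.update p g 0) D σ)
              (pinD (Function.update p g 1) D fun x => !σ x)) := by
    intro σ _
    rw [gform_pin Q U e (pinD p D σ) (pinD p D fun x => !σ x) g,
      pinD_of_not_mem p σ hg, pinD_of_not_mem p (fun x => !σ x) hg,
      ← pinD_update p σ hg, ← pinD_update p σ hg, ← pinD_update p (fun x => !σ x) hg,
      ← pinD_update p (fun x => !σ x) hg]
    ring
  rw [sum_congr rfl key, sum_add_distrib, sum_add_distrib, ← mul_sum, ← mul_sum, ← mul_sum,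
    sum_add_distrib]

end Forms

section FreeEdges

variable {E : Type*} [Fintype E] [DecidableEq E] {R : Type*} [Field R] [DecidableEq R]

/-- The free edges of `(D, p)`: the edges outside `D` whose weight is neither `0` nor `1`. -/
def freeEdges (D : Finset E) (p : E → R) : Finset E :=
  (univ \ D).filter fun x => p x ≠ 0 ∧ p x ≠ 1

/-- Membership in `freeEdges`. -/
lemma mem_freeEdges {D : Finset E} {p : E → R} {x : E} :
    x ∈ freeEdges D p ↔ x ∉ D ∧ p x ≠ 0 ∧ p x ≠ 1 := by
  simp [freeEdges]

/-- Pinning a free edge to a degenerate value removes it from the free edges. -/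
lemma freeEdges_update (D : Finset E) (p : E → R) {g : E} (hg : g ∈ freeEdges D p) {v : R}
    (hv : v = 0 ∨ v = 1) : freeEdges D (Function.update p g v) = (freeEdges D p).erase g := by
  ext x
  simp only [mem_freeEdges, mem_erase]
  by_cases hx : x = g
  · subst hx
    simp only [Function.update_self, ne_eq, not_true_eq_false, false_and, iff_false]
    rintro ⟨-, h0, h1⟩
    rcases hv with rfl | rfl
    · exact h0 rfl
    · exact h1 rfl
  · simp [hx]

/-- Moving a free edge into `D` removes it from the free edges. -/
lemma freeEdges_insert (D : Finset E) (p : E → R) (g : E) :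
    freeEdges (insert g D) p = (freeEdges D p).erase g := by
  ext x
  simp only [mem_freeEdges, mem_erase, mem_insert, not_or]
  tauto

omit [DecidableEq R] in
/-- `K_∅(p)` is the one-law form `gform p p`. -/
lemma kform_empty (Q U e : Set (Config E)) (p : E → R) :
    kform Q U e ∅ p = gform Q U e p p := by
  unfold kform
  have hs : suppOn (∅ : Finset E) = {fun _ => false} := by
    ext σ
    simp only [mem_suppOn, notMem_empty, not_false_eq_true, forall_const, mem_singleton]
    constructor
    · intro h; funext x; exact h x
    · intro h x; rw [h]
  rw [hs, sum_singleton, pinD_empty, pinD_empty]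

end FreeEdges

section Main

variable {E : Type*} [Fintype E] [DecidableEq E] {R : Type*} [Field R] [LinearOrder R]
  [IsStrictOrderedRing R]

/-- **The reduction theorem.** If every antipodal base case is nonnegative — `K_D(a) ≥ 0` whenever
the admissible weights `a` are `0/1`-valued off `D` — then `K_D(p) ≥ 0` for every `D` and every
admissible `p`. -/
theorem kform_nonneg_of_base (Q U e : Set (Config E))
    (hbase : ∀ (D : Finset E) (a : E → R), IsProbVec a → (∀ x, x ∉ D → a x = 0 ∨ a x = 1) →
      0 ≤ kform Q U e D a) :
    ∀ (D : Finset E) (p : E → R), IsProbVec p → 0 ≤ kform Q U e D p := by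
  suffices h : ∀ n : ℕ, ∀ (D : Finset E) (p : E → R), IsProbVec p → (freeEdges D p).card = n →
      0 ≤ kform Q U e D p from fun D p hp => h _ D p hp rfl
  intro n
  induction n with
  | zero =>
    intro D p hp hn
    apply hbase D p hp
    intro x hx
    by_cases h0 : p x = 0
    · exact Or.inl h0
    by_cases h1 : p x = 1
    · exact Or.inr h1
    exfalso
    have hmem : x ∈ freeEdges D p := mem_freeEdges.2 ⟨hx, h0, h1⟩
    rw [card_eq_zero] at hn
    rw [hn] at hmem
    exact notMem_empty x hmem
  | succ n ih =>
    intro D p hp hn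
    obtain ⟨g, hg⟩ : (freeEdges D p).Nonempty := by
      rw [← card_pos, hn]; exact Nat.succ_pos n
    have hgD : g ∉ D := (mem_freeEdges.1 hg).1
    have hcard : ((freeEdges D p).erase g).card = n := by
      rw [card_erase_of_mem hg, hn]; rfl
    have h0 : 0 ≤ kform Q U e D (Function.update p g 0) :=
      ih D _ (hp.update g le_rfl zero_le_one) (by rw [freeEdges_update D p hg (Or.inl rfl), hcard])
    have h1 : 0 ≤ kform Q U e D (Function.update p g 1) :=
      ih D _ (hp.update g zero_le_one le_rfl) (by rw [freeEdges_update D p hg (Or.inr rfl), hcard])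
    have h2 : 0 ≤ kform Q U e (insert g D) p :=
      ih (insert g D) p hp (by rw [freeEdges_insert D p g, hcard])
    rw [kform_pin Q U e hgD p]
    have hpg0 : 0 ≤ p g := hp.nonneg g
    have hpg1 : 0 ≤ 1 - p g := sub_nonneg.2 (hp.le_one g)
    exact add_nonneg (add_nonneg (mul_nonneg (sq_nonneg _) h0) (mul_nonneg (sq_nonneg _) h1))
      (mul_nonneg (mul_nonneg hpg0 hpg1) h2)

/-- **(T) from the antipodal base cases**: for admissible weights and ARBITRARY events `Q U e`,
`P(Q ∩ U) P(e) + P(Q ∩ e) P(U) ≤ P(Q ∩ U ∩ e) + P(Q) P(U ∩ e)` as soon as every base case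
`K_D(a) ≥ 0` (`a` admissible, `0/1`-valued off `D`). -/
theorem tform_nonneg_of_base (Q U e : Set (Config E))
    (hbase : ∀ (D : Finset E) (a : E → R), IsProbVec a → (∀ x, x ∉ D → a x = 0 ∨ a x = 1) →
      0 ≤ kform Q U e D a) (p : E → R) (hp : IsProbVec p) :
    prob p (Q ∩ U) * prob p e + prob p (Q ∩ e) * prob p U ≤
      prob p (Q ∩ U ∩ e) + prob p Q * prob p (U ∩ e) := by
  have h := kform_nonneg_of_base Q U e hbase ∅ p hp
  rw [kform_empty] at h
  unfold gform at h
  linarith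

end Main

end TReduction

end Summit.Ventures.PercRepro2
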